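import Literature.MathematicalPhysics.QuantumFieldTheory.Balaban1983to89.B2Eq265HiggsTowerPow
import Literature.MathematicalPhysics.QuantumFieldTheory.Balaban1983to89.B2Eq244Cutoff

/-!
# `Balaban1983to89.B2Eq265TowerWitness` — [Balaban1982Higgs2] Lemma 2.4 (2.65) p.572 on the (Higgs)₂,₃ carrier of record, print's own
# regions: THE HYPOTHESIS TELESCOPE OF F16 `B2Eq265HiggsTowerPow.eq265_higgs_tower_pow_r` IS JOINTLY SATISFIABLE — an explicit torus of the
# sub-family `Shape` (`M = L^{Mmin}`), the (2.7)–(2.8)/(2.43) tower with no large-field points (`bad := ∅`, print's radii `r(Lⁱε)`), the cell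
# box `□₂ = [0, M(2m+1))ᵈ`, the cube `□₁` of radius `R₁ = ⌈θ₂r(Lᵏε)⌉` about `x_k`, margin `m ≥ max(R₁, θ₁r(Lᵏε), 2M(d+2)+3)`, the (2.44)
# cut-off `zeta244` (support radius 3, plateau 0), `R_n = 4`, `n = 2L < r(Lʲε)` (mesh `≤ e^{−2L/R}`), zero fields and letters — all forty-odd
# hypotheses discharged by the kernel at every step `j` (`tower_pow_r_hypotheses_inhabited`), and F16 APPLIED to it (`…_inhabited`)

statement-level skeleton of published theorems with citation tags; proofs where landed; nothing here is a claim
about the Yang–Mills mass gap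

PDF held: `paper:balaban1982-cmp86-higgs23-ii` (journal page = PDF page + 554), p. 572 [PDF 18] (Lemma 2.4), p. 570 [PDF 16] ((2.55)/(2.56)),
p. 558 [PDF 4] ((2.7)–(2.8)), p. 566 [PDF 12] ((2.43)/(2.44)); part I `paper:balaban1982-cmp85-higgs23-i` p. 604 [PDF 2] ((1.2) «ε⁻¹L_μ =
L^K M L′_μ, K, L, M, L′_μ are some positive integers»).

CITATION HEADER (lean-in-tree rule).  T. Bałaban, *(Higgs)₂,₃ quantum fields in a finite volume. II. An upper bound*,
Commun. Math. Phys. **86** (1982) 555–594, doi:10.1007/bf01214890 [Balaban1982Higgs2].  Cell `lit-balaban` (HOME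
`run/shared/lean/pub/lit-balaban/`), Phase-2 proof seat **p23** gen 23 (unit `lit-balaban-p23-g23`; free-target protocol G.5-34(d), TAKING #2
line HOME/STATUS.md 2026-08-23); SKELETON row **B2.Lem2.4** (fold owner r02, second reader r14; head `proved p250408 · …` UNCHANGED —
cells-only NON-VACUITY WITNESS for the member F16, in the manner of own gen-20 `B2Lemma24ModelWitness` for the row's (K5) criterion).
USED BY NAME, never restated: the typer's carrier `HiggsLattice.Params`/`Site`/`sitesPerDir`, `B1Eq211ZeroFieldTorus.Shape`,
`B2Eq255Concrete.{Restr255, underRegion}`, `B2Eq243RegionsTower.{towerRegion, towerRegion_eq_univ_of_no_bad}`, `B2Eq324NestedRegions.prime`,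
`B2Eq28RegionsConcrete.near`, p35's `B1Ineq225RegularBox.{cellBox, cellOf}`, `B1TorusCubeCover.half`, `B1TorusCubeLocality26.rS`, own gen-12
`B2Eq244Cutoff.{zeta244, abs_zeta244_le_one, zeta244_supp, zeta244_eq_one, zeta244_lip}`, p15's `B2Ineq329ZeroAveraging.val_blockIter`,
`B3MultiscaleFields.zeroCharge`, r14's `B2Lemma23HiggsLattice.cutMin`, `B3Ineq210RegularTorus.mesh_mono`, b2b's `B2.rFn`/`B2.Params.Printed`.

WHY.  F16's `eq265_higgs_tower_pow_r` (and behind it F12–F15) carries some forty hypotheses (torus sub-family and sizes, the cell-box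
geometry of `□ = Bᵏ(□₂)`, the depth inequality `2r_S + 2·half·(d+1) + 1 ≤ Lᵏm`, the cube `□₁` and its centre, the four (2.44) properties of
`ζ^{(k)}`, the (2.8) room condition, the radii readings, the three `δ_A` scalings, (2.55)); an implication with unsatisfiable hypotheses would
be vacuous — this file certifies once that they are jointly satisfiable (the row's (K5) question, B2-CLOSURE §32/§32o, for the tower member).

WHAT THIS FILE PROVES (kernel-checked, zero `sorry`; theorems only — NO definition, NO `Prop`-valued fact; axioms standard; the explicit
torus is a `HiggsLattice.Params` literal inside the proof: `K = j + 1`, `M = L^{Mmin}`, `L′_μ = Lᵇ`, `ε = min(ε₀, 1, e^{−2L/R})/L^{j+1}`).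
 §1 **`tower_pow_r_hypotheses_inhabited`**: for all outer parameters of `eq265_higgs_tower_pow_r` with `0 < ε₀`, all `δ, C_V, C_F`, all
 `Mmin`: `∃ M ≥ Mmin` (`M = L^{Mmin}`) such that for all `e₁, t > 0` and EVERY step index `j` there are `P` (`Shape P`, `P.d = d`, `P.L = L`,
 `P.M = M`, `P.K = j + 1`), `bad`, `□₂, □₁, S, q, Sbox, q₁, R₁, m, ζ, ρ, ρ₁, R_n, n, C₀, A′, c₁, pℓ, t_A, t_φ, δ_A, e_c, x, φ` satisfying the
 hypothesis telescope of `eq265_higgs_tower_pow_r` — the statement below IS that telescope with `∀/→` turned into `∃/∧`, binder for binder,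
 in the same order (the one deviation: `j` is universally quantified — the witness exists at every step);
 §2 **`eq265_higgs_tower_pow_r_inhabited`**: F16's theorem APPLIED to the witness — its (2.65) bound holds for the witness data at every
 `j` (the kernel's check that §1's telescope is F16's, binder for binder).

HONEST SCOPE (recorded, not hidden; one sentence each).  (a) A MODEL INSTANCE, DEGENERATE BY DESIGN in the analytic data: what is
witnessed is the JOINT SATISFIABILITY of the forty-odd hypotheses (torus sub-family and sizes, the geometry of `□ = Bᵏ(□₂)`/`□₁`/margins/
depth, the four (2.44) properties, the (2.8) room condition, the radii readings with `θ₁, θ₂`, the three `δ_A` scalings, (2.55)) with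
`bad := ∅` and ZERO fields and letters (`c₁ = pℓ = t_A = t_φ = 0` forces `A′ = 0`, `φ = 0` through (2.55); `δ_A = 0`, `e_c = e₁`) — the
degenerate admissible choice, which is all a non-vacuity certificate needs (as own gen-20 (K5) witness `B2Lemma24ModelWitness`).
(b) UNIFORMITY — which binders are served universally and which chosen: ALL outer parameters of F16 are universal (`ε₀ > 0` is needed:
for `ε₀ ≤ 0` the hypothesis `Lᵏε ≤ ε₀` is unsatisfiable and F16 is vacuous there, correctly), `δ, C_V, C_F, Mmin, e₁, t` universal, the
step `j` universal; CHOSEN: `M = L^{Mmin}` (a `Shape` torus needs `M·L′_μ` a power of `L`, so the theorem's `∀ M ≥ Mmin` is met at such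
`M`, not at an arbitrary integer), the lattice `P` with `P.K = j + 1`, `L′_μ = Lᵇ` (`b = 2m + 10`), and all the data listed in (a).  (c) No
large-field points (all tower regions `= T^{(j)}`); print's intended configuration (`□₁, □₂` about `y ∈ Λ₇′`, non-zero fields) is NOT
exercised; the cut-off has support radius `ρ = 3`, plateau `ρ₁ = 0` (legal (2.44) data, not print's `r(Lᵏε) − 2M`, `½r`).  (d) Zero head
weight; NOT summit progress; nothing minted (theorems only).
-/

open scoped BigOperators

noncomputable section

namespace Literature.MathematicalPhysics.QuantumFieldTheory.Balaban1983to89.B2Eq265TowerWitness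

open HiggsLattice (ChargeData)
open HiggsAveraging (blockIter toFinest)
open HiggsCovariance (avgQkAdj)
open B2Eq255Concrete (bgScalar256 Restr255 underRegion mem_underRegion dA absA dPhi absPhi)
open B2Eq324NestedRegions (prime mem_prime)
open B2Eq243RegionsTower (towerRegion towerRegion_eq_univ_of_no_bad)
open B2Eq28RegionsConcrete (near subset_near)
open B2Eq244Cutoff (zeta244 abs_zeta244_le_one zeta244_supp zeta244_eq_one zeta244_lip)
open B2Ineq329ZeroAveraging (val_blockIter)
open B2Lemma23HiggsLattice (cutMin)
open B1Eq211ZeroFieldTorus (Shape)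
open B3MultiscaleFields (toSite ofSite zeroCharge)
open B1Ineq225RegularBox (cellBox mem_cellBox cellOf)
open B1TorusCubeCover (half)
open B1TorusCubeLocality26 (rS)

/-! ## §1 The hypothesis telescope of `eq265_higgs_tower_pow_r` is inhabited -/

/-- **NON-VACUITY OF LEMMA 2.4'S TOWER MEMBER.**  The hypothesis telescope of own F16 `B2Eq265HiggsTowerPow.eq265_higgs_tower_pow_r` with
`∀/→` turned into `∃/∧`, binder for binder and in the same order (only `j` made universal), is inhabited: for all outer parameters
(`ε₀ > 0`), all `δ, C_V, C_F`, all `Mmin` there is `M ≥ Mmin` such that for all `e₁, t > 0` and every step `j` an explicit torus of the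
sub-family with `P.M = M`, the no-large-field tower (`bad := ∅`) with print's radii `r(Lⁱε)`, a cell box `□₂ ⊇` the margin-`m`
neighbourhood of `x_k`, the cube `□₁` of radius `R₁` centred at `x_k`, the (2.44) cut-off `zeta244`, `R_n = 4`, `n = 2L`, the zero charge
datum, `A′ = 0`, the letters `c₁ = pℓ = t_A = t_φ = 0`, `δ_A = 0`, `e_c = e₁`, and `φ = 0` satisfy every hypothesis.
[cite: Balaban1982Higgs2, Lemma 2.4 (2.65) p.572] [cite: Balaban1982Higgs2, (2.55)–(2.56) p.570, (2.7)–(2.8) p.558, (2.43)–(2.44) p.566]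
[cite: Balaban1982Higgs1, (1.2) p.604] -/
theorem tower_pow_r_hypotheses_inhabited (d L : ℕ) (hd : 1 ≤ d) (hL : Odd L ∧ 1 < L)
    (aV mu0sq : ℝ) (N : ℕ) (C : ChargeData N) {ε₀ : ℝ} (hε₀ : 0 < ε₀) (creg β : ℝ) (hcreg : 0 ≤ creg)
    (Q : B2.Params) (hQ : Q.Printed) {T : ℝ} (hT : 0 ≤ T) (mexp θ₁ θ₂ : ℝ)
    (δ CV CF : ℝ) (Mmin : ℕ) :
    ∃ M : ℕ, Mmin ≤ M ∧ ∀ (e₁ t : ℝ), 0 < e₁ → 0 < t → ∀ (j : ℕ),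
      ∃ (P : HiggsLattice.Params) (_ : Shape P), P.d = d ∧ P.L = L ∧ P.M = M ∧
      j + 1 ≤ P.K ∧ (∀ μ, 3 * half P (j + 1) M ≤ P.sitesPerDir 0 μ) ∧ P.mesh (j + 1) ≤ ε₀ ∧ P.mesh (j + 1) ≤ 1 ∧
      ∃ (bad : (l : ℕ) → Set (HiggsLattice.Site P l))
        (sq₂ sq₁ : Finset (HiggsLattice.Site P (j + 1))) (S : Fin P.d → Finset ℕ) (q : HiggsLattice.Site P (j + 1)) (Sbox : ℕ),
        sq₂ ⊆ prime (towerRegion bad (fun i => B2.rFn Q.R Q.r (P.mesh i)) j 2) ∧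
        sq₁ ⊆ prime (towerRegion bad (fun i => B2.rFn Q.R Q.r (P.mesh i)) j 6) ∧
        underRegion (j + 1) sq₂ = cellBox (j + 1) M S ∧
        (∀ μ : Fin P.d, P.L ^ (j + 1) * Sbox < P.sitesPerDir 0 μ) ∧
        (∀ y : HiggsLattice.Site P (j + 1), y ∈ sq₂ ↔ ∀ ν : Fin P.d, (y ν - q ν).val < Sbox) ∧
        (∀ μ : Fin P.d, 2 * (P.L ^ (j + 1) * Sbox) ≤ P.sitesPerDir 0 μ) ∧
      ∃ (q₁ : HiggsLattice.Site P (j + 1)) (R₁ m : ℕ), R₁ ≤ m ∧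
        2 * rS P (j + 1) M + 2 * half P (j + 1) M * (P.d + 1) + 1 ≤ P.L ^ (j + 1) * m ∧
        (∀ y : HiggsLattice.Site P (j + 1), y ∈ sq₁ ↔ ∀ ν : Fin P.d, (y ν - q₁ ν).val < 2 * R₁ + 1) ∧
      ∃ (ζ : HiggsLattice.Site P 0 → HiggsLattice.Site P (j + 1) → ℝ) (ρ ρ₁ : ℝ), 0 ≤ ρ₁ ∧
        (∀ x y', |ζ x y'| ≤ 1) ∧
        (∀ x y', ζ x y' ≠ 0 → (HiggsLattice.Site.tdist (blockIter (j + 1) x) y' : ℝ) ≤ ρ) ∧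
        (∀ x y', (HiggsLattice.Site.tdist (blockIter (j + 1) x) y' : ℝ) ≤ ρ₁ → ζ x y' = 1) ∧
        (∀ (x : HiggsLattice.Site P 0) (ν : Fin P.d) (y' : HiggsLattice.Site P (j + 1)), |ζ (x.shift ν) y' - ζ x y'| ≤ ((P.L : ℝ) ^ (j + 1))⁻¹) ∧
      ∃ (Rn : ℕ), ρ + 1 ≤ (Rn : ℝ) ∧ (∀ μ : Fin P.d, 2 * (2 * Rn + 1) ≤ P.sitesPerDir (j + 1) μ) ∧
      ∃ (n : ℕ), (n : ℝ) < B2.rFn Q.R Q.r (P.mesh j) ∧ (P.L : ℝ) * ((Rn : ℝ) + 1) - 1 ≤ 3 * (n : ℝ) ∧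
      ∃ (C₀ : ChargeData P.d) (A' : HiggsLattice.VecField P (j + 1)) (c₁ pℓ tA tPhi : ℝ), 0 ≤ c₁ ∧ 0 ≤ pℓ ∧ 0 ≤ tPhi ∧
        θ₁ * B2.rFn Q.R Q.r (P.mesh (j + 1)) ≤ (m : ℝ) ∧ θ₂ * B2.rFn Q.R Q.r (P.mesh (j + 1)) ≤ (R₁ : ℝ) + 1 ∧
        c₁ * tPhi * pℓ ≤ T * P.mesh (j + 1) ^ (-mexp) ∧
      ∃ (δA : ℝ), ((P.L : ℝ) ^ (j + 1))⁻¹ * (CV * P.d * (P.mesh (j + 1) * (c₁ * pℓ)) + CF * Real.exp (-(δ * ρ₁)) * (c₁ * tA * pℓ)) ≤ δA ∧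
          (P.L : ℝ) ^ (j + 1) * δA * |C.e| ≤ t ∧
        ∃ (ec : ℝ), 0 < ec ∧ ec ≤ e₁ ∧ (P.L : ℝ) ^ (j + 1) * P.mesh (j + 1) * |C.e| * δA ≤ creg * ec ^ β ∧
      ∃ (x : HiggsLattice.Site P 0),
        (∀ ν : Fin P.d, m ≤ ((blockIter (j + 1) x) ν - q ν).val ∧ ((blockIter (j + 1) x) ν - q ν).val + m < Sbox) ∧
        (∀ ν : Fin P.d, ((blockIter (j + 1) x) ν - q₁ ν).val = R₁) ∧
      ∃ (φ : HiggsLattice.ScalarField P (j + 1) N),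
        Restr255 C c₁ pℓ tA tPhi (j + 1)
          (prime (near (towerRegion bad (fun i => B2.rFn Q.R Q.r (P.mesh i)) j 0) (B2.rFn Q.R Q.r (P.mesh j)))) A' φ
          (ofSite (cutMin C₀ mu0sq aV (j + 1) ζ (toSite A'))) := by
  -- the printed ranges: `R > 0`, `r > 1`, `L > 1` odd
  have hR : 0 < Q.R := hQ.2.2.2.2.2.2.2
  have hr1 : 1 < Q.r := hQ.2.1
  have hL1 : 1 < L := hL.2
  have hL0 : 0 < L := lt_trans Nat.zero_lt_one hL1
  have hLR : (1 : ℝ) < L := by exact_mod_cast hL1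
  -- `M = L^{Mmin} > Mmin`
  have hM1 : 1 ≤ L ^ Mmin := Nat.one_le_pow _ _ hL0
  refine ⟨L ^ Mmin, (Nat.lt_pow_self hL1 : Mmin < L ^ Mmin).le, ?_⟩
  intro e₁ t he₁ ht j
  -- the mesh at level `k = j + 1`: `s = min(ε₀, 1, e^{−2L/R})`
  set c : ℝ := 2 * L / Q.R with hc_def
  set s : ℝ := min (min ε₀ 1) (Real.exp (-c)) with hs_def
  have hs0 : 0 < s := lt_min (lt_min hε₀ one_pos) (Real.exp_pos _)
  have hsε₀ : s ≤ ε₀ := (min_le_left _ _).trans (min_le_left _ _)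
  have hs1 : s ≤ 1 := (min_le_left _ _).trans (min_le_right _ _)
  have hsexp : s ≤ Real.exp (-c) := min_le_right _ _
  have hLk0 : 0 < L ^ (j + 1) := pow_pos hL0 _
  have hLk1 : 1 ≤ L ^ (j + 1) := Nat.one_le_pow _ _ hL0
  have hLk : (0 : ℝ) < (L : ℝ) ^ (j + 1) := pow_pos (by exact_mod_cast hL0) _
  set ε : ℝ := s / (L : ℝ) ^ (j + 1) with hε_def
  have hε : 0 < ε := div_pos hs0 hLk
  -- the radius at level `k` and the box data
  set rk : ℝ := B2.rFn Q.R Q.r s with hrk_def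
  set R₁ : ℕ := ⌈θ₂ * rk⌉₊ with hR₁_def
  set m : ℕ := max (max R₁ ⌈θ₁ * rk⌉₊) (2 * L ^ Mmin * (d + 2) + 3) with hm_def
  have hR₁m : R₁ ≤ m := (le_max_left _ _).trans (le_max_left _ _)
  have hm₁ : ⌈θ₁ * rk⌉₊ ≤ m := (le_max_right _ _).trans (le_max_left _ _)
  have hm₀ : 2 * L ^ Mmin * (d + 2) + 3 ≤ m := le_max_right _ _
  set b : ℕ := 2 * m + 10 with hb_def
  have hbpow : b < L ^ b := Nat.lt_pow_self hL1
  have hLb9 : 9 ≤ L ^ b := by omega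
  have hLbm : 2 * m + 1 < L ^ b := by omega
  -- THE TORUS (I.1.2) with `K = j + 1`, `M = L^{Mmin}`, `L′_μ = Lᵇ` in every direction (so `M·L′_μ = L^{Mmin+b}`: the sub-family `Shape`)
  set P : HiggsLattice.Params :=
    { d := d, ε := ε, K := j + 1, L := L, M := L ^ Mmin, Lp := fun _ => L ^ b, hd := hd, hε := hε, hL := hL0,
      hM := pow_pos hL0 Mmin, hLp := fun _ => pow_pos hL0 b } with hP_def
  have S : Shape P := ⟨Mmin + b, hL, fun _ => (pow_add L Mmin b).symm⟩
  have hPd : P.d = d := rfl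
  have hPL : P.L = L := rfl
  have hPM : P.M = L ^ Mmin := rfl
  have hsitesk : ∀ μ : Fin P.d, P.sitesPerDir (j + 1) μ = 2 * (L ^ Mmin * L ^ b) := by
    intro μ
    show 2 * (L ^ (j + 1 - (j + 1)) * L ^ Mmin * L ^ b) = _
    rw [Nat.sub_self, pow_zero, one_mul]
  have hsites0 : ∀ μ : Fin P.d, P.sitesPerDir 0 μ = 2 * (L ^ (j + 1) * L ^ Mmin * L ^ b) := fun μ => rfl
  have hmeshk : P.mesh (j + 1) = s := by
    show (L : ℝ) ^ (j + 1) * (s / (L : ℝ) ^ (j + 1)) = s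
    field_simp
  have hkK : j + 1 ≤ P.K := le_rfl
  have hhalf : half P (j + 1) (L ^ Mmin) = L ^ (j + 1) * L ^ Mmin := rfl
  refine ⟨P, S, rfl, rfl, rfl, le_rfl, ?_, hmeshk ▸ hsε₀, hmeshk ▸ hs1, ?_⟩
  · -- `3·half ≤ |T_ε|`: `3 Lᵏ M ≤ 2 Lᵏ M Lᵇ`
    intro μ
    rw [hsites0, hhalf]
    calc 3 * (L ^ (j + 1) * L ^ Mmin) ≤ (2 * L ^ b) * (L ^ (j + 1) * L ^ Mmin) :=
          Nat.mul_le_mul_right _ (by omega)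
      _ = 2 * (L ^ (j + 1) * L ^ Mmin * L ^ b) := by ring
  -- THE TOWER WITHOUT LARGE FIELDS, THE BOXES
  set rad : ℕ → ℝ := fun i => B2.rFn Q.R Q.r (P.mesh i) with hrad_def
  set bad : (l : ℕ) → Set (HiggsLattice.Site P l) := fun _ => ∅ with hbad_def
  have htower : ∀ i, towerRegion bad rad j i = Finset.univ := towerRegion_eq_univ_of_no_bad (fun _ => rfl) j
  have hprime : ∀ i, prime (towerRegion bad rad j i) = (Finset.univ : Finset (HiggsLattice.Site P (j + 1))) := by
    intro i
    rw [htower i]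
    exact Finset.eq_univ_iff_forall.mpr fun y => (mem_prime _ y).mpr fun x _ => Finset.mem_univ x
  set Sbox : ℕ := L ^ Mmin * (2 * m + 1) with hSbox_def
  set q : HiggsLattice.Site P (j + 1) := fun _ => 0 with hq_def
  set sq₂ : Finset (HiggsLattice.Site P (j + 1)) :=
    Finset.univ.filter fun y => ∀ ν : Fin P.d, (y ν - q ν).val < Sbox with hsq₂_def
  set Sfin : Fin P.d → Finset ℕ := fun _ => Finset.range (2 * m + 1) with hSfin_def
  set q₁ : HiggsLattice.Site P (j + 1) := fun ν => ((m - R₁ : ℕ) : ZMod (P.sitesPerDir (j + 1) ν)) with hq₁_def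
  set sq₁ : Finset (HiggsLattice.Site P (j + 1)) :=
    Finset.univ.filter fun y => ∀ ν : Fin P.d, (y ν - q₁ ν).val < 2 * R₁ + 1 with hsq₁_def
  have hmem₂ : ∀ y : HiggsLattice.Site P (j + 1), y ∈ sq₂ ↔ ∀ ν : Fin P.d, (y ν - q ν).val < Sbox := by
    intro y; simp [hsq₂_def]
  have hmem₁ : ∀ y : HiggsLattice.Site P (j + 1), y ∈ sq₁ ↔ ∀ ν : Fin P.d, (y ν - q₁ ν).val < 2 * R₁ + 1 := by
    intro y; simp [hsq₁_def]
  have hq0 : ∀ ν : Fin P.d, q ν = 0 := fun ν => rfl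
  refine ⟨bad, sq₂, sq₁, Sfin, q, Sbox, by rw [hprime]; exact Finset.subset_univ _, by rw [hprime]; exact Finset.subset_univ _,
    ?_, ?_, hmem₂, ?_, q₁, R₁, m, hR₁m, ?_, hmem₁, ?_⟩
  · -- `Bᵏ(□₂) = cellBox`: `⌊x_ν/Lᵏ⌋ < M(2m+1) ↔ ⌊x_ν/(LᵏM)⌋ < 2m+1`
    ext x
    rw [mem_underRegion, hmem₂, mem_cellBox]
    refine forall_congr' fun ν => ?_
    rw [hq0, sub_zero, val_blockIter hkK]
    show (x ν).val / L ^ (j + 1) < Sbox ↔ (x ν).val / (L ^ (j + 1) * L ^ Mmin) ∈ Finset.range (2 * m + 1)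
    rw [Finset.mem_range, Nat.div_lt_iff_lt_mul hLk0, Nat.div_lt_iff_lt_mul (Nat.mul_pos hLk0 hM1),
      show Sbox * L ^ (j + 1) = (2 * m + 1) * (L ^ (j + 1) * L ^ Mmin) by rw [hSbox_def]; ring]
  · intro μ
    rw [hsites0, hPL, hSbox_def]
    have hX : 0 < L ^ (j + 1) * L ^ Mmin := Nat.mul_pos hLk0 hM1
    calc L ^ (j + 1) * (L ^ Mmin * (2 * m + 1)) = (L ^ (j + 1) * L ^ Mmin) * (2 * m + 1) := by ring
      _ < (L ^ (j + 1) * L ^ Mmin) * L ^ b := Nat.mul_lt_mul_of_pos_left hLbm hX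
      _ ≤ 2 * (L ^ (j + 1) * L ^ Mmin * L ^ b) := by omega
  · intro μ
    rw [hsites0, hPL, hSbox_def]
    calc 2 * (L ^ (j + 1) * (L ^ Mmin * (2 * m + 1))) = 2 * ((L ^ (j + 1) * L ^ Mmin) * (2 * m + 1)) := by ring
      _ ≤ 2 * ((L ^ (j + 1) * L ^ Mmin) * L ^ b) := Nat.mul_le_mul_left _ (Nat.mul_le_mul_left _ hLbm.le)
      _ = 2 * (L ^ (j + 1) * L ^ Mmin * L ^ b) := by ring
  · -- the depth inequality `2r_S + 2·half·(d+1) + 1 ≤ Lᵏm` from `m ≥ 2M(d+2) + 3`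
    have hX : rS P (j + 1) (L ^ Mmin) ≤ L ^ (j + 1) * L ^ Mmin + L ^ (j + 1) := by
      unfold rS
      rw [hhalf, hPL]
      omega
    rw [hhalf, hPd, hPL]
    calc 2 * rS P (j + 1) (L ^ Mmin) + 2 * (L ^ (j + 1) * L ^ Mmin) * (d + 1) + 1
        ≤ 2 * (L ^ (j + 1) * L ^ Mmin + L ^ (j + 1)) + 2 * (L ^ (j + 1) * L ^ Mmin) * (d + 1) + L ^ (j + 1) :=
          Nat.add_le_add (Nat.add_le_add (Nat.mul_le_mul_left 2 hX) le_rfl) hLk1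
      _ = L ^ (j + 1) * (2 * L ^ Mmin * (d + 2) + 3) := by ring
      _ ≤ L ^ (j + 1) * m := Nat.mul_le_mul_left _ hm₀
  -- THE CUT-OFF `ζ^{(k)}` (support radius 3, plateau 0), `R_n = 4`, `n = 2L`
  refine ⟨zeta244 P (j + 1) 3, 3, 0, le_rfl, fun x y' => abs_zeta244_le_one 3 x y', fun x y' h => zeta244_supp hkK h,
    fun x y' h => zeta244_eq_one hkK (by norm_num) h, fun x ν y' => zeta244_lip 3 x ν y', 4, by norm_num, ?_, 2 * L,
    ?_, ?_, ?_⟩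
  · intro μ
    rw [hsitesk]
    calc 2 * (2 * 4 + 1) = 2 * 9 := by norm_num
      _ ≤ 2 * (L ^ Mmin * L ^ b) := Nat.mul_le_mul_left 2 (le_trans hLb9 (Nat.le_mul_of_pos_left _ hM1))
  · -- `2L < r(Lʲε)`: `Lʲε ≤ Lᵏε = s ≤ e^{−2L/R}` ⇒ `log (Lʲε)⁻¹ ≥ 2L/R` ⇒ `R(1 + log)^r ≥ R(1 + 2L/R) > 2L`
    have hmj : P.mesh j ≤ s := hmeshk ▸ B3Ineq210RegularTorus.mesh_mono P (Nat.le_succ j)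
    have hmj0 : 0 < P.mesh j := P.mesh_pos j
    have hexpc : Real.exp c ≤ (P.mesh j)⁻¹ := by
      rw [le_inv_comm₀ (Real.exp_pos c) hmj0, ← Real.exp_neg]
      exact hmj.trans hsexp
    have hlog : c ≤ Real.log (P.mesh j)⁻¹ := (Real.le_log_iff_exp_le (inv_pos.mpr hmj0)).mpr hexpc
    have hc0 : 0 < c := by rw [hc_def]; positivity
    have hbase : 1 ≤ 1 + Real.log (P.mesh j)⁻¹ := by linarith
    have hpow : 1 + Real.log (P.mesh j)⁻¹ ≤ (1 + Real.log (P.mesh j)⁻¹) ^ Q.r := by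
      have := Real.rpow_le_rpow_of_exponent_le hbase hr1.le
      rwa [Real.rpow_one] at this
    have hrj : Q.R * (1 + c) ≤ B2.rFn Q.R Q.r (P.mesh j) := by
      unfold B2.rFn
      exact mul_le_mul_of_nonneg_left (by linarith) hR.le
    have hRc : Q.R * (1 + c) = Q.R + 2 * L := by
      rw [hc_def]; field_simp
    push_cast
    linarith
  · rw [hPL]; push_cast; nlinarith [hLR]
  -- THE ZERO CHARGE, ZERO FIELD, ZERO LETTERS; the radii readings; `δ_A = 0`, `e_c = e₁`
  have hθ₁m : θ₁ * B2.rFn Q.R Q.r (P.mesh (j + 1)) ≤ (m : ℝ) := by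
    rw [hmeshk]
    have h1 : θ₁ * rk ≤ ⌈θ₁ * rk⌉₊ := Nat.le_ceil _
    have h2 : (⌈θ₁ * rk⌉₊ : ℝ) ≤ m := by exact_mod_cast hm₁
    exact h1.trans h2
  have hθ₂R : θ₂ * B2.rFn Q.R Q.r (P.mesh (j + 1)) ≤ (R₁ : ℝ) + 1 := by
    rw [hmeshk]
    have h1 : θ₂ * rk ≤ ⌈θ₂ * rk⌉₊ := Nat.le_ceil _
    have h2 : (⌈θ₂ * rk⌉₊ : ℝ) = R₁ := by rw [hR₁_def]
    linarith
  have hT' : (0 : ℝ) * 0 * 0 ≤ T * P.mesh (j + 1) ^ (-mexp) := by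
    rw [show (0 : ℝ) * 0 * 0 = 0 by ring]
    exact mul_nonneg hT (Real.rpow_nonneg (P.mesh_pos _).le _)
  have htoSite0 : toSite (0 : HiggsLattice.VecField P (j + 1)) = 0 := by
    funext z
    show WithLp.toLp 2 (0 : Fin P.d → ℝ) = 0
    exact WithLp.toLp_zero 2
  have h60 : ((P.L : ℝ) ^ (j + 1))⁻¹ * (CV * P.d * (P.mesh (j + 1) * (0 * 0)) + CF * Real.exp (-(δ * 0)) * (0 * 0 * 0)) ≤ 0 := by
    simp
  have ht' : (P.L : ℝ) ^ (j + 1) * 0 * |C.e| ≤ t := by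
    rw [mul_zero, zero_mul]; exact ht.le
  have hsm : (P.L : ℝ) ^ (j + 1) * P.mesh (j + 1) * |C.e| * 0 ≤ creg * e₁ ^ β := by
    rw [mul_zero]; exact mul_nonneg hcreg (Real.rpow_nonneg he₁.le _)
  refine ⟨zeroCharge P.d, 0, 0, 0, 0, 0, le_rfl, le_rfl, le_rfl, hθ₁m, hθ₂R, hT', 0, h60, ht', e₁, he₁, le_rfl, hsm, ?_⟩
  -- THE FINE POINT `x` over the coarse site `(m, …, m)`: margin `m` in `□₂ = [0, M(2m+1))ᵈ`, centre of `□₁`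
  have hmk : ∀ ν : Fin P.d, m < P.sitesPerDir (j + 1) ν := by
    intro ν
    rw [hsitesk]
    have : L ^ b ≤ L ^ Mmin * L ^ b := Nat.le_mul_of_pos_left _ hM1
    omega
  have hm0 : ∀ ν : Fin P.d, m * L ^ (j + 1) < P.sitesPerDir 0 ν := by
    intro ν
    rw [hsites0]
    have h1 : L ^ b ≤ L ^ Mmin * L ^ b := Nat.le_mul_of_pos_left _ hM1
    have h2 : m < L ^ Mmin * L ^ b := by omega
    calc m * L ^ (j + 1) < (L ^ Mmin * L ^ b) * L ^ (j + 1) := Nat.mul_lt_mul_of_pos_right h2 hLk0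
      _ ≤ 2 * (L ^ (j + 1) * L ^ Mmin * L ^ b) := by
          rw [show (L ^ Mmin * L ^ b) * L ^ (j + 1) = L ^ (j + 1) * L ^ Mmin * L ^ b by ring]; omega
  let x : HiggsLattice.Site P 0 := fun ν => ((m * L ^ (j + 1) : ℕ) : ZMod (P.sitesPerDir 0 ν))
  have hxval : ∀ ν : Fin P.d, (x ν).val = m * L ^ (j + 1) := fun ν => ZMod.val_natCast_of_lt (hm0 ν)
  have hbx : ∀ ν : Fin P.d, (blockIter (j + 1) x ν).val = m := by
    intro ν
    rw [val_blockIter hkK, hxval, hPL, Nat.mul_div_cancel _ hLk0]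
  have hbx' : ∀ ν : Fin P.d, blockIter (j + 1) x ν = ((m : ℕ) : ZMod (P.sitesPerDir (j + 1) ν)) := by
    intro ν
    rw [← hbx ν, ZMod.natCast_zmod_val]
  refine ⟨x, ?_, ?_, 0, ?_⟩
  · intro ν
    rw [hq0, sub_zero, hbx, hSbox_def]
    refine ⟨le_rfl, ?_⟩
    have : 2 * m + 1 ≤ L ^ Mmin * (2 * m + 1) := Nat.le_mul_of_pos_left _ hM1
    omega
  · intro ν
    rw [hbx']
    show (((m : ℕ) : ZMod (P.sitesPerDir (j + 1) ν)) - ((m - R₁ : ℕ) : ZMod (P.sitesPerDir (j + 1) ν))).val = R₁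
    rw [← Nat.cast_sub (Nat.sub_le m R₁), Nat.sub_sub_self hR₁m, ZMod.val_natCast_of_lt ((hR₁m.trans_lt (hmk ν)))]
  · -- (2.55) for the zero fields with zero letters
    refine ⟨fun bnd _ => ?_, fun y _ => ?_, fun bnd _ => ?_, fun y _ => ?_⟩
    · unfold dA HiggsLattice.sderiv
      rw [htoSite0]
      simp
    · unfold absA
      rw [htoSite0]
      simp
    · unfold dPhi HiggsLattice.covDeriv
      simp
    · unfold absPhi
      simp

/-! ## §2 The tower theorem applied to the witness: its (2.65) bound is inhabited -/

/-- **SHAPE CHECK BY THE KERNEL**: the witness of §1 discharges EVERY hypothesis of own F16 `B2Eq265HiggsTowerPow.eq265_higgs_tower_pow_r`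
binder for binder — the theorem applied to it yields its (2.65) value-clause bound for the witness data at every step `j` (for all outer
parameters of the theorem, `ε₀ > 0`): the universally quantified implication is NOT vacuous. [cite: Balaban1982Higgs2, Lemma 2.4 (2.65) p.572]
[cite: Balaban1982Higgs2, (2.55)–(2.56) p.570, (2.7)–(2.8) p.558, (2.43)–(2.44) p.566] -/
theorem eq265_higgs_tower_pow_r_inhabited (d L : ℕ) (hd : 1 ≤ d) (hL : Odd L ∧ 1 < L) {a : ℝ} (ha : 0 < a) {msq : ℝ} (hmsq : 0 < msq)
    {aV : ℝ} (haV : 0 < aV) {mu0sq : ℝ} (hmu0 : 0 < mu0sq)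
    (N : ℕ) (C : ChargeData N) {ε₀ : ℝ} (hε₀ : 0 < ε₀) (creg β : ℝ) (hcreg : 0 ≤ creg) (hβ : 0 < β)
    (Q : B2.Params) (hQ : Q.Printed) {T : ℝ} (hT : 0 ≤ T) (mexp : ℝ) {θ₁ θ₂ : ℝ} (hθ₁ : 0 < θ₁) (hθ₂ : 0 < θ₂) (κ : ℝ) :
    ∃ (M : ℕ) (C₃ D₁ D₂ D₃ D₄ C' : ℝ), ∀ (j : ℕ),
      ∃ (P : HiggsLattice.Params) (_ : Shape P) (bad : (l : ℕ) → Set (HiggsLattice.Site P l))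
        (ζ : HiggsLattice.Site P 0 → HiggsLattice.Site P (j + 1) → ℝ) (C₀ : ChargeData P.d) (A' : HiggsLattice.VecField P (j + 1))
        (c₁ pℓ tPhi δA : ℝ) (Sbox R₁ : ℕ) (x : HiggsLattice.Site P 0) (φ : HiggsLattice.ScalarField P (j + 1) N),
        ‖bgScalar256 C msq a (j + 1) (prime (towerRegion bad (fun i => B2.rFn Q.R Q.r (P.mesh i)) j 2))
              (prime (towerRegion bad (fun i => B2.rFn Q.R Q.r (P.mesh i)) j 6))
              (ofSite (cutMin C₀ mu0sq aV (j + 1) ζ (toSite A'))) φ x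
            - avgQkAdj C (ofSite (cutMin C₀ mu0sq aV (j + 1) ζ (toSite A'))) (j + 1) φ x‖
          ≤ C' * B1.aSeq a P.L (j + 1) * P.mesh (j + 1) ^ κ
            + (D₁ * P.mesh (j + 1) ^ 2 *
                (B1.aSeq a P.L (j + 1) * (P.mesh (j + 1))⁻¹ ^ 2 * (|C.e| * (δA * (P.d * ((P.L : ℝ) ^ (j + 1) * Sbox))) * P.mesh 0 * (P.d * ((P.L : ℝ) ^ (j + 1) - 1))) * (c₁ * tPhi * pℓ)
                  + |C.e| * (δA * (P.d * ((P.L : ℝ) ^ (j + 1) * Sbox))) * (P.d * ((B1.aSeq a P.L (j + 1) * (P.mesh (j + 1))⁻¹ ^ 2 * (c₁ * tPhi * pℓ) * D₄ * P.mesh (j + 1)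
                        + |C.e| * (δA * (P.d * ((P.L : ℝ) ^ (j + 1) * Sbox))) * (B1.aSeq a P.L (j + 1) * D₃ * (c₁ * tPhi * pℓ))) + |C.e| * (δA * (P.d * ((P.L : ℝ) ^ (j + 1) * Sbox))) * (B1.aSeq a P.L (j + 1) * D₃ * (c₁ * tPhi * pℓ))))
                  + B1.aSeq a P.L (j + 1) * (P.mesh (j + 1))⁻¹ ^ 2 *
                      ((2 * (|C.e| * (δA * (P.d * ((P.L : ℝ) ^ (j + 1) * Sbox))) * P.mesh 0 * (P.d * ((P.L : ℝ) ^ (j + 1) - 1)))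
                        + (|C.e| * (δA * (P.d * ((P.L : ℝ) ^ (j + 1) * Sbox))) * P.mesh 0 * (P.d * ((P.L : ℝ) ^ (j + 1) - 1))) ^ 2) * (B1.aSeq a P.L (j + 1) * D₃ * (c₁ * tPhi * pℓ))))
              + D₂ * P.mesh (j + 1) * (|C.e| * (δA * (P.d * ((P.L : ℝ) ^ (j + 1) * Sbox))) * (B1.aSeq a P.L (j + 1) * D₃ * (c₁ * tPhi * pℓ))))
            + B1.aSeq a P.L (j + 1) * C₃ *
                (4 * M * ((P.mesh (j + 1) * (c₁ * pℓ) + P.mesh (j + 1) * |C.e| * (δA * (P.d * ((P.L : ℝ) ^ (j + 1) * Sbox))) * (c₁ * tPhi * pℓ)) * P.d)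
                  + Real.exp (-(1 / (4 * M) * ((R₁ : ℝ) + 1))) * (c₁ * tPhi * pℓ))
            + msq * P.mesh (j + 1) ^ 2 / (B1.aSeq a P.L (j + 1) + msq * P.mesh (j + 1) ^ 2) * (c₁ * tPhi * pℓ)
            + |C.e| * P.mesh 0 * (P.d * ((P.L : ℝ) ^ (j + 1) - 1)) * (δA * (P.d * ((P.L : ℝ) ^ (j + 1) * Sbox))) * (c₁ * tPhi * pℓ) := by
  obtain ⟨δ, CV, CF, _hδ, _hCV, _hCF, Mmin, h⟩ :=
    B2Eq265HiggsTowerPow.eq265_higgs_tower_pow_r d L hd hL ha hmsq haV hmu0 N C ε₀ creg β hcreg hβ Q hQ hT mexp hθ₁ hθ₂ κ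
  obtain ⟨M, hM, w⟩ := tower_pow_r_hypotheses_inhabited d L hd hL aV mu0sq N C hε₀ creg β hcreg Q hQ hT mexp θ₁ θ₂ δ CV CF Mmin
  obtain ⟨e₁, t, he₁, ht, C₁, C₂, C₃, D₁, D₂, D₃, D₄, _hC₁, _hC₂, _hC₃, _hD₁, _hD₂, _hD₃, _hD₄, C', _hC', h⟩ := h M hM
  refine ⟨M, C₃, D₁, D₂, D₃, D₄, C', fun j => ?_⟩
  obtain ⟨P, S, hPd, hPL, hPM, hjK, h3, hε, h1, bad, sq₂, sq₁, Sfin, q, Sbox, hs2, h16, hbox, hSbox, hsq₂, h2S, q₁, R₁, m, hR₁m,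
    hRm, hsq₁, ζ, ρ, ρ₁, hρ₁, za, zs, zo, zl, Rn, hRn, hRn2, n, hn, hroom, C₀, A', c₁, pℓ, tA, tPhi, hc₁, hpℓ, htPhi, hθm, hθR, htT,
    δA, h60δ, ht', ec, hec, hle, hsmall, x, hmargin, hcentre, φ, h255⟩ := w e₁ t he₁ ht j
  exact ⟨P, S, bad, ζ, C₀, A', c₁, pℓ, tPhi, δA, Sbox, R₁, x, φ,
    h P S hPd hPL hPM hjK h3 hε h1 bad sq₂ sq₁ Sfin q Sbox hs2 h16 hbox hSbox hsq₂ h2S q₁ R₁ m hR₁m hRm hsq₁ ζ ρ ρ₁ hρ₁ za zs zo zl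
      Rn hRn hRn2 n hn hroom C₀ A' hc₁ hpℓ htPhi hθm hθR htT h60δ ht' hec hle hsmall x hmargin hcentre φ h255⟩

end Literature.MathematicalPhysics.QuantumFieldTheory.Balaban1983to89.B2Eq265TowerWitness

end
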